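import Summits.ValiantsHypothesis.ValiantsHypothesis.Theorems.KPlusLogSqLawTropicalBMarkedEdgeCoreRising

/-!
# Route «KPlusLogSqLaw», crux `TropicalB` (stmt-ValiantsHypothesis-19771) — MARKED-EDGE sector, NESTED-TRIANGLE CORE, ALL sizes:
# the HEIGHT FUNCTION — a finite digraph without cycles has a strictly increasing numbering; applied to the relative arcs of a realisation

HONEST FRAMING.  Helper file (cell `pub-symmetroid`, seat val-sym-trop-p4 (g21), 2026-08-29; `--supports stmt-ValiantsHypothesis-19771 --as
helper`).  Infrastructure for the rising-chain picture behind the located THEOREM D1 (memo HOME/val-sym-trop-p4/g21/RIGIDITY-g21.md): every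
closed walk of a relation without simple cycles is impossible (`noClosedWalk_of_noCycle`, minimal-counterexample extraction), hence the
transitive closure is irreflexive and «number of ancestors» is a height (`exists_height_of_noCycle`); in a realisation of the nested-triangle
core the relative arcs `i → j` (`σZ j ∈ {σB i, σC i, σE i}`, `i, j ∉ {b0, b4}`, `i ≠ j`) therefore admit a height `h : V → ℕ` that strictly
increases along every arc (`core_exists_height`, from `core_noRelCycle` of `…CoreRising`).  Nothing here proves the nested-triangle law; nothing concerns
`TropicalB` in its window, `WeakLifting`, the doors, `MatrixDescartes` (stmt-ValiantsHypothesis-18050) or VP ≠ VNP.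
-/

set_option linter.dupNamespace false
set_option autoImplicit false

namespace Summit.ValiantsHypothesis.ValiantsHypothesis.Theorems.KPlusLogSqLaw
namespace MarkedEdge
namespace Core

open Finset

variable {V : Type*}

/-- A transitive-closure step yields a walk: `TransGen R a c` gives `f : ℕ → V`, `n ≥ 1`, `f 0 = a`, `f n = c`, consecutive `R`. [folklore] -/
theorem walk_of_transGen (R : V → V → Prop) {a c : V} (h : Relation.TransGen R a c) :
    ∃ n : ℕ, 1 ≤ n ∧ ∃ f : ℕ → V, f 0 = a ∧ f n = c ∧ ∀ k < n, R (f k) (f (k + 1)) := by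
  induction h with
  | @single c' hac =>
    exact ⟨1, le_rfl, fun k => if k = 0 then a else c', by simp, by simp, fun k hk => by
      have hk0 : k = 0 := by omega
      subst hk0; simpa using hac⟩
  | @tail b' c' _ hbc ih =>
    obtain ⟨n, hn, f, hf0, hfn, hR⟩ := ih
    refine ⟨n + 1, by omega, fun k => if k ≤ n then f k else c', by simp [hf0], by simp, fun k hk => ?_⟩
    by_cases hkn : k < n
    · have h1 : k ≤ n := hkn.le
      have h2 : k + 1 ≤ n := hkn
      simp only [h1, h2, if_true]; exact hR k hkn
    · have hk' : k = n := by omega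
      subst hk'
      have h3 : ¬ (k + 1 ≤ k) := by omega
      simp only [le_refl, if_true, h3, if_false, hfn]; exact hbc

/-- **No closed walk.**  If a relation `R` has no simple cycle (no `Nodup` list of length ≥ 2 cyclically related by `R`) and no loop, then it has
no closed walk of any positive length. (Minimal counterexample: a shortest closed walk has distinct nodes.) [folklore] -/
theorem noClosedWalk_of_noCycle [DecidableEq V] (R : V → V → Prop)
    (hcyc : ∀ l : List V, l.Nodup → 2 ≤ l.length → (∀ i ∈ l, R i (l.formPerm i)) → False) (hirr : ∀ i, ¬ R i i) :
    ∀ n : ℕ, 1 ≤ n → ∀ f : ℕ → V, f n = f 0 → (∀ k < n, R (f k) (f (k + 1))) → False := by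
  intro n
  induction n using Nat.strong_induction_on with
  | _ n ih =>
    intro hn f hclosed hR
    -- either two equal nodes among f 0, …, f (n-1), or they are distinct
    by_cases hinj : ∀ k₁ k₂, k₁ < k₂ → k₂ < n → f k₁ ≠ f k₂
    · -- distinct: the list of nodes is a simple cycle (or a loop if n = 1)
      by_cases h1 : n = 1
      · subst h1
        have := hR 0 (by omega)
        rw [zero_add, hclosed] at this
        exact hirr _ this
      · set l : List V := List.ofFn (fun k : Fin n => f k) with hl
        have hlen : l.length = n := by simp [hl]
        have hnd : l.Nodup := by
          rw [hl, List.nodup_ofFn]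
          intro k₁ k₂ hk
          rcases lt_trichotomy (k₁ : ℕ) k₂ with hlt | heq | hgt
          · exact absurd hk (hinj _ _ hlt k₂.isLt)
          · exact Fin.ext heq
          · exact absurd hk.symm (hinj _ _ hgt k₁.isLt)
        refine hcyc l hnd (by omega) ?_
        intro i hi
        rw [hl, List.mem_ofFn] at hi
        obtain ⟨k, rfl⟩ := hi
        have hget : l[(k : ℕ)]'(by rw [hlen]; exact k.isLt) = f k := by simp [hl]
        rw [← hget, List.formPerm_apply_getElem l hnd (k : ℕ) (by rw [hlen]; exact k.isLt)]
        simp only [hl, List.getElem_ofFn, List.length_ofFn]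
        by_cases hk : (k : ℕ) + 1 < n
        · rw [Nat.mod_eq_of_lt hk]; exact hR k k.isLt
        · have hk' : (k : ℕ) + 1 = n := by omega
          have hmod : ((k : ℕ) + 1) % n = 0 := by rw [hk', Nat.mod_self]
          rw [hmod, ← hclosed]
          have := hR k k.isLt
          rwa [hk'] at this
    · -- a repeated node: cut out the shorter closed walk between the two occurrences
      push Not at hinj
      obtain ⟨k₁, k₂, h12, h2n, heq⟩ := hinj
      refine ih (k₂ - k₁) (by omega) (by omega) (fun k => f (k₁ + k)) ?_ ?_
      · show f (k₁ + (k₂ - k₁)) = f (k₁ + 0)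
        rw [Nat.add_sub_cancel' h12.le, add_zero, heq]
      · intro k hk
        show R (f (k₁ + k)) (f (k₁ + (k + 1)))
        rw [← add_assoc]; exact hR _ (by omega)

/-- **Irreflexive transitive closure.**  Under the hypotheses of `noClosedWalk_of_noCycle`, no node reaches itself. [folklore] -/
theorem not_transGen_self_of_noCycle [DecidableEq V] (R : V → V → Prop)
    (hcyc : ∀ l : List V, l.Nodup → 2 ≤ l.length → (∀ i ∈ l, R i (l.formPerm i)) → False) (hirr : ∀ i, ¬ R i i) (a : V) :
    ¬ Relation.TransGen R a a := by
  intro h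
  obtain ⟨n, hn, f, hf0, hfn, hR⟩ := walk_of_transGen R h
  exact noClosedWalk_of_noCycle R hcyc hirr n hn f (by rw [hfn, hf0]) hR

/-- **HEIGHT FUNCTION.**  A relation on a finite type without simple cycles and without loops admits `h : V → ℕ` with `h i < h j` whenever
`R i j` (take `h j` = the number of nodes from which `j` is reachable). [folklore: topological numbering of a finite acyclic digraph] -/
theorem exists_height_of_noCycle [Fintype V] [DecidableEq V] (R : V → V → Prop)
    (hcyc : ∀ l : List V, l.Nodup → 2 ≤ l.length → (∀ i ∈ l, R i (l.formPerm i)) → False) (hirr : ∀ i, ¬ R i i) :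
    ∃ h : V → ℕ, ∀ i j, R i j → h i < h j := by
  classical
  refine ⟨fun j => (Finset.univ.filter fun i => Relation.TransGen R i j).card, fun i j hij => ?_⟩
  apply Finset.card_lt_card
  rw [Finset.ssubset_iff_of_subset]
  · refine ⟨i, ?_, ?_⟩
    · simp only [Finset.mem_filter, Finset.mem_univ, true_and]; exact Relation.TransGen.single hij
    · simp only [Finset.mem_filter, Finset.mem_univ, true_and]; exact not_transGen_self_of_noCycle R hcyc hirr i
  · intro k hk
    simp only [Finset.mem_filter, Finset.mem_univ, true_and] at hk ⊢
    exact hk.tail hij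


section Core

variable [Fintype V] [DecidableEq V] (ok : V → V → Prop) (w g : V → V → ℤ) (b : Fin 5 → V)

/-- **HEIGHT FUNCTION OF A REALISATION.**  In any realisation of the nested-triangle core there is `h : V → ℕ` such that for all nodes
`i ≠ j` outside the gates `b0, b4`, a relative arc `i → j` (`σZ j ∈ {σB i, σC i, σE i}`) forces `h i < h j`.  In words: one linear order of
`V ∖ {b0, b4}` along which `σZ⁻¹σB`, `σZ⁻¹σC`, `σZ⁻¹σE` all move upward (gate arcs excepted). [this seat's theorem; `core_BCEZ_unique` +
`exists_height_of_noCycle`] -/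
theorem core_exists_height (hb : Function.Injective b)
    (hoff : ∀ i j, j ≠ i → g i j = 0) (hmark : ∀ l, g (b l) (b l) = (2 : ℤ) ^ (l : ℕ)) (haux : ∀ i, (∀ l, b l ≠ i) → g i i = 0)
    {θB θC θE θZ : ℤ} {σB σC σE σZ : Equiv.Perm V} (hBC : θB < θC) (hCE : θC < θE) (hEZ : θE < θZ)
    (hB : (∀ i, ok i (σB i)) ∧ ∀ τ : Equiv.Perm V, τ ≠ σB → (∀ i, ok i (τ i)) →
      ∑ i, (w i (τ i) + θB * g i (τ i)) < ∑ i, (w i (σB i) + θB * g i (σB i)))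
    (hC : (∀ i, ok i (σC i)) ∧ ∀ τ : Equiv.Perm V, τ ≠ σC → (∀ i, ok i (τ i)) →
      ∑ i, (w i (τ i) + θC * g i (τ i)) < ∑ i, (w i (σC i) + θC * g i (σC i)))
    (hE : (∀ i, ok i (σE i)) ∧ ∀ τ : Equiv.Perm V, τ ≠ σE → (∀ i, ok i (τ i)) →
      ∑ i, (w i (τ i) + θE * g i (τ i)) < ∑ i, (w i (σE i) + θE * g i (σE i)))
    (hZ : (∀ i, ok i (σZ i)) ∧ ∀ τ : Equiv.Perm V, τ ≠ σZ → (∀ i, ok i (τ i)) →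
      ∑ i, (w i (τ i) + θZ * g i (τ i)) < ∑ i, (w i (σZ i) + θZ * g i (σZ i)))
    (hB0 : σB (b 0) ≠ b 0) (hB1 : σB (b 1) = b 1) (hB2 : σB (b 2) = b 2) (hB3 : σB (b 3) ≠ b 3) (hB4 : σB (b 4) ≠ b 4)
    (hC0 : σC (b 0) ≠ b 0) (hC1 : σC (b 1) = b 1) (hC2 : σC (b 2) ≠ b 2) (hC3 : σC (b 3) = b 3) (hC4 : σC (b 4) ≠ b 4)
    (hE0 : σE (b 0) ≠ b 0) (hE1 : σE (b 1) ≠ b 1) (hE2 : σE (b 2) = b 2) (hE3 : σE (b 3) = b 3) (hE4 : σE (b 4) ≠ b 4)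
    (hZ0 : σZ (b 0) = b 0) (hZ1 : σZ (b 1) ≠ b 1) (hZ2 : σZ (b 2) ≠ b 2) (hZ3 : σZ (b 3) ≠ b 3) (hZ4 : σZ (b 4) = b 4) :
    ∃ h : V → ℕ, ∀ i j : V, i ≠ b 0 → i ≠ b 4 → j ≠ b 0 → j ≠ b 4 → i ≠ j →
      (σZ j = σB i ∨ σZ j = σC i ∨ σZ j = σE i) → h i < h j := by
  -- the relative-arc relation restricted to non-gate nodes
  let R : V → V → Prop := fun i j => i ≠ b 0 ∧ i ≠ b 4 ∧ j ≠ b 0 ∧ j ≠ b 4 ∧ i ≠ j ∧ (σZ j = σB i ∨ σZ j = σC i ∨ σZ j = σE i)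
  have hirr : ∀ i, ¬ R i i := fun i h => h.2.2.2.2.1 rfl
  have hcyc : ∀ l : List V, l.Nodup → 2 ≤ l.length → (∀ i ∈ l, R i (l.formPerm i)) → False := by
    intro l hl h2 harc
    have h0 : b 0 ∉ l := fun hm => (harc _ hm).1 rfl
    have h4 : b 4 ∉ l := fun hm => (harc _ hm).2.1 rfl
    exact core_noRelCycle ok w g b hb hoff hmark haux hBC hCE hEZ hB hC hE hZ hB0 hB1 hB2 hB3 hB4 hC0 hC1 hC2 hC3 hC4
      hE0 hE1 hE2 hE3 hE4 hZ0 hZ1 hZ2 hZ3 hZ4 l hl h2 h0 h4 (fun i hi => (harc i hi).2.2.2.2.2)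
  obtain ⟨h, hh⟩ := exists_height_of_noCycle R hcyc hirr
  exact ⟨h, fun i j hi0 hi4 hj0 hj4 hij harc => hh i j ⟨hi0, hi4, hj0, hj4, hij, harc⟩⟩

end Core

end Core
end MarkedEdge
end Summit.ValiantsHypothesis.ValiantsHypothesis.Theorems.KPlusLogSqLaw
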